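import Summits.AtomisticToContinuum.Crystallization.Theorems.FrustratedLawDichotomyStrainedPatchHomSlopeLJThird

/-!
# The SECOND-ORDER CENTRED affine slope leaf of the pure LJ profile (K1-v2 of the sheet-tracking lever), part A: kernel arrays, Boolean, per-label algebra
# (27623 `(H) HomFloor (1/625)`, hcp half; hand-1 g34 FINDING §4)

decomp-a2c hand-1 g34 (crux `AperiodicFrustratedLawGap`, stmt-AtomisticToContinuum-27623).  KERNEL DIAGNOSIS (hand-1 g34, `…HomEntryLeafHTACells`): along the
affine reference `ξ₀(U) = ξ_c + J(U − U_c)` the first-order slope term is `≈ 1/500` of the constant-reference one, but the per-label SECOND-order remainder of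
the first-order centred form `…HomSlopeLJAffine.slopeCheckLJA` (`Σ_b K_b/2·nd2_b`, no cross-label cancellation) dominates from entry half-width `2⁻¹¹` on.
The second-order centred form: with `d_b,k = Σ_a M_b,k,a D_a + s_k` (`M_b = wPt_b ⊗ 1 + U_cJ`, `D_a` the nine entry deviations, `s` the `O(w²)` shift
residual of `…HomSlopeLJAffine.shift_affine_decomp`), the quadratic term `½ Σ_b D³φ(p_b)[d_b, d_b, Δ]` (`…HomSlopeLJThird.quadSlope_eq`) is the quadratic
form `½ Σ_aa' D_a D_a' Q_i[a,a']`, `Q_i[a,a'] = Σ_b Σ_kk' M_b,k,a M_b,k',a' Dreal_b(k,k',i)` ACCUMULATED OVER LABELS before the absolute value (kernel `QarrLJA2`,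
enclosed through the curvature kit's `Darr (recLJ …)`), plus the `s`-residual (`resQ`, `O(w³)`) and the third-order remainder `Σ_b K₃,b/6·nd3_b` (`rem3LJ`):

* §1 kernel: `MfiA`/`Mre` (+ `mem_MfiA`), `sum9` (+ `mem_sum9`), `QarrLJA2`, `mDb`, `resQ`, `quadVec2`, `quadL2`, `KSl3`, `rem3LJ`, ★ `slopeCheckLJA2 c w J Lc Ln Gs`,
  `slopeGsLJA2`, `slopeCheckLJA2_slopeGsLJA2`;
* §2 `label_slope3_LJ_of_ok`, `rem3LJ_sum_le`, `sum4_comm`, ★ `quad_expand` (per-label quadratic form through the entry deviations), ★ `sum_Mre_eq`.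
Soundness (`slopeLJA2_bound_of_check`) is part B (`…HomSlopeLJAffine2`).  KERNEL (seat probes `R2–R4`, near chunk): W10 `7.6e-4·SC` (first-order form
`1.2e-2`, constant reference `1.8e-2`), `cB065` cube `2⁻¹⁰` `1.07e-3` (`1.6e-2` / `2.0e-2`), cube `2⁻⁹` `6.8e-3` (`7.1e-2` / `5.5e-2`).

Kernel definitions + lemmas; 0 sorry; standard axioms; no instances / notation / `#eval`.  `--supports stmt-AtomisticToContinuum-27623`.
-/

noncomputable section

namespace Summit.AtomisticToContinuum.Crystallization.Theorems.FrustratedLawDichotomyStrainedPatchHomSlopeLJAffine2Kit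

open scoped BigOperators RealInnerProductSpace
open Literature.Analysis.ValidatedNumerics.Numerics
open Literature.Analysis.ValidatedNumerics.IntervalGershgorin (lsum)
open Summit.AtomisticToContinuum.Crystallization.Theorems.ChargedEnergyGapNegative (E3)
open Summit.AtomisticToContinuum.Crystallization.Theorems.FrustratedLawDichotomyStrainedPatchHomSplit (latPt hexFrame hcpShift)
open Summit.AtomisticToContinuum.Crystallization.Theorems.FrustratedLawDichotomyStrainedPatchHomCoords (apply_eq_sum_entries)
open Summit.AtomisticToContinuum.Crystallization.Theorems.FrustratedLawDichotomyStrainedPatchHomEntryGram (entryFI mem_entryFI)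
open Summit.AtomisticToContinuum.Crystallization.Theorems.FrustratedLawDichotomyStrainedPatchHomEntryGramHcp (dot3 shufFI mem_dot3 mem_shufFI)
open Summit.AtomisticToContinuum.Crystallization.Theorems.FrustratedLawDichotomyStrainedPatchHomForceKit (vecB mem_vecB phiFI)
open Summit.AtomisticToContinuum.Crystallization.Theorems.FrustratedLawDichotomyStrainedPatchHomCurvKit (accFI mem_accFI)
open Summit.AtomisticToContinuum.Crystallization.Theorems.FrustratedLawDichotomyStrainedPatchHomConvexCurvature (segG_zero_eq inner_eq_sum3)
open Summit.AtomisticToContinuum.Crystallization.Theorems.FrustratedLawDichotomyStrainedPatchHomCurvCentre (pert_rearrange pert_abs_le)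
open Summit.AtomisticToContinuum.Crystallization.Theorems.FrustratedLawDichotomyStrainedPatchHomCurvCentreKit
open Summit.AtomisticToContinuum.Crystallization.Theorems.FrustratedLawDichotomyStrainedPatchHomCurvRegime3
open Summit.AtomisticToContinuum.Crystallization.Theorems.FrustratedLawDichotomyStrainedPatchHomCurvLeafL (dflt3)
open Summit.AtomisticToContinuum.Crystallization.Theorems.FrustratedLawDichotomyStrainedPatchHomCurvCoeff3 (ljTripleFI mem_ljTripleFI)
open Summit.AtomisticToContinuum.Crystallization.Theorems.FrustratedLawDichotomyStrainedPatchHomSlopeLeafC (abs_sum_mul_le_sqrtHi H0r linSlope_eq)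
open Summit.AtomisticToContinuum.Crystallization.Theorems.FrustratedLawDichotomyStrainedPatchHomCurvLJ
  (betaLJ_eq_profile A0lj B0lj A1qlj a1qLJ ttLJ t0LJ Q0 KSlj recLJ ljLabelOK naiveLJ mem_naiveLJ)
open Summit.AtomisticToContinuum.Crystallization.Theorems.FrustratedLawDichotomyStrainedPatchHomSlopeLJ
open Summit.AtomisticToContinuum.Crystallization.Theorems.FrustratedLawDichotomyStrainedPatchHomSlopeLJAffine
open Summit.AtomisticToContinuum.Crystallization.Theorems.FrustratedLawDichotomyStrainedPatchHomSlopeLJThird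
open Summit.AtomisticToContinuum.Crystallization.Theorems.FrustratedLawDichotomyStrainedPatchHomForceRing (segG_ljProfile_zero)
open Summit.AtomisticToContinuum.Crystallization.Theorems.FrustratedLawDichotomyStrainedPatchTaylorChord (segR segG)
open Summit.AtomisticToContinuum.Crystallization.Theorems.FrustratedLawDichotomyStrainedPatchHomLatticeBoxHcp (norm_shifted_gt)

/-! ## §1. The kernel arrays and the Boolean -/

/-- `M_b,k,a`: the coefficient of the entry deviation `D_a` (`a = (k',l')`) in `d_b,k`: `δ_kk' (w_b)_l' + cJ_k,a`. -/
def MfiA (c : (Fin 3 × Fin 3) ⊕ Fin 3 → ℤ) (J : Fin 3 → Fin 3 × Fin 3 → ℤ) (b : Fin 3 → ℤ) (k : Fin 3) (a : Fin 3 × Fin 3) : FI :=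
  if k = a.1 then (wVec c b a.2).add (cJ c J k a) else cJ c J k a

/-- Its real value. -/
def Mre (c : (Fin 3 × Fin 3) ⊕ Fin 3 → ℤ) (J : Fin 3 → Fin 3 × Fin 3 → ℤ) (b : Fin 3 → ℤ) (k : Fin 3) (a : Fin 3 × Fin 3) : ℝ :=
  (if k = a.1 then wPt c b a.2 else 0) + cJr c J k a

/-- ★ `MfiA` encloses `Mre`. [folklore] -/
theorem mem_MfiA (c : (Fin 3 × Fin 3) ⊕ Fin 3 → ℤ) (J : Fin 3 → Fin 3 × Fin 3 → ℤ) (b : Fin 3 → ℤ) (k : Fin 3) (a : Fin 3 × Fin 3) :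
    FI.mem (Mre c J b k a) (MfiA c J b k a) := by
  unfold Mre MfiA
  split_ifs with h
  · exact FI.mem_add (mem_wVec c b a.2) (mem_cJ c J k a)
  · rw [zero_add]; exact mem_cJ c J k a

/-- Sum of a `3 × 3` table of intervals. -/
def sum9 (f : Fin 3 → Fin 3 → FI) : FI :=
  ((((f 0 0).add (f 0 1)).add (f 0 2)).add (((f 1 0).add (f 1 1)).add (f 1 2))).add (((f 2 0).add (f 2 1)).add (f 2 2))

/-- ★ `sum9` encloses the double sum. [folklore] -/
theorem mem_sum9 {g : Fin 3 → Fin 3 → ℝ} {f : Fin 3 → Fin 3 → FI} (h : ∀ k k', FI.mem (g k k') (f k k')) :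
    FI.mem (∑ k : Fin 3, ∑ k' : Fin 3, g k k') (sum9 f) := by
  simp only [Fin.sum_univ_three, sum9]
  exact FI.mem_add (FI.mem_add (FI.mem_add (FI.mem_add (h 0 0) (h 0 1)) (h 0 2)) (FI.mem_add (FI.mem_add (h 1 0) (h 1 1)) (h 1 2)))
    (FI.mem_add (FI.mem_add (h 2 0) (h 2 1)) (h 2 2))

/-- ★ THE CROSS-LABEL-COMBINED QUADRATIC ARRAY `Q_i[a,a'] = Σ_b Σ_k Σ_k' M_b,k,a M_b,k',a' Dreal_b(k,k',i)` (label records on the hull box). -/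
def QarrLJA2 (c w : (Fin 3 × Fin 3) ⊕ Fin 3 → ℤ) (J : Fin 3 → Fin 3 × Fin 3 → ℤ) (Lc : List (Fin 3 → ℤ)) (i : Fin 3) (a a' : Fin 3 × Fin 3) : FI :=
  accFI Lc fun b => sum9 fun k k' => (MfiA c J b k a).mul ((MfiA c J b k' a').mul (Darr (recLJ c (hullW J w) b) k k' i))

/-- Scaled bound of `|(M_b D)_k|`: `⌈Σ_a |M_b,k,a|↑ w_a / SC⌉`. -/
def mDb (c w : (Fin 3 × Fin 3) ⊕ Fin 3 → ℤ) (J : Fin 3 → Fin 3 × Fin 3 → ℤ) (b : Fin 3 → ℤ) (k : Fin 3) : ℤ :=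
  cdiv (∑ a : Fin 3 × Fin 3, (MfiA c J b k a).absHi * w (Sum.inl a)) SC

/-- Scaled residual of the shift residual `s` in the quadratic term: `Σ_b Σ_kk' ⌈(mD_k uA_k' + uA_k mD_k' + uA_k uA_k')·|Dreal_b|↑ / SC⌉`. -/
def resQ (c w : (Fin 3 × Fin 3) ⊕ Fin 3 → ℤ) (J : Fin 3 → Fin 3 × Fin 3 → ℤ) (Lc : List (Fin 3 → ℤ)) (i : Fin 3) : ℤ :=
  (Lc.map fun b => ∑ k : Fin 3, ∑ k' : Fin 3,
    cdiv ((mDb c w J b k * ubA J w k' + ubA J w k * mDb c w J b k' + ubA J w k * ubA J w k') * (Darr (recLJ c (hullW J w) b) k k' i).absHi) SC).sum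

/-- Scaled componentwise bound of HALF the quadratic term. -/
def quadVec2 (c w : (Fin 3 × Fin 3) ⊕ Fin 3 → ℤ) (J : Fin 3 → Fin 3 × Fin 3 → ℤ) (Lc : List (Fin 3 → ℤ)) (i : Fin 3) : ℤ :=
  cdiv (∑ a : Fin 3 × Fin 3, ∑ a' : Fin 3 × Fin 3, cdiv (w (Sum.inl a) * w (Sum.inl a')) SC * (QarrLJA2 c w J Lc i a a').absHi + resQ c w J Lc i) (2 * SC)

/-- Scaled `ℓ²` bound of half the quadratic term. -/
def quadL2 (c w : (Fin 3 × Fin 3) ⊕ Fin 3 → ℤ) (J : Fin 3 → Fin 3 × Fin 3 → ℤ) (Lc : List (Fin 3 → ℤ)) : ℤ :=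
  (FI.sqrt ⟨0, cdiv (∑ i : Fin 3, quadVec2 c w J Lc i ^ 2) SC⟩).hi

/-- Scaled third-order remainder constant of a label. -/
def KSl3 (c w : (Fin 3 × Fin 3) ⊕ Fin 3 → ℤ) (b : Fin 3 → ℤ) : ℤ := kSlope3S ((ttLJ c w b).getD dflt3)

/-- Scaled third-order remainder `Σ_b ⌈K₃,b · nd3_b / (6 SC)⌉`. -/
def rem3LJ (c w : (Fin 3 × Fin 3) ⊕ Fin 3 → ℤ) (Lc : List (Fin 3 → ℤ)) : ℤ := (Lc.map fun b => cdiv (KSl3 c w b * nd3S c w b) (6 * SC)).sum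

/-- ★ **THE SECOND-ORDER CENTRED AFFINE LJ SLOPE CHECK** (label guards of the curvature kit on the hull box). -/
def slopeCheckLJA2 (c w : (Fin 3 × Fin 3) ⊕ Fin 3 → ℤ) (J : Fin 3 → Fin 3 × Fin 3 → ℤ) (Lc Ln : List (Fin 3 → ℤ)) (Gs : ℤ) : Bool :=
  (Lc.all fun b => ljLabelOK c (hullW J w) b) && (Ln.all fun b => (naiveLJ c (hullW J w) b).isSome) &&
    decide (g0LJ c Lc + linLJA c w J Lc + quadL2 c w J Lc + rem3LJ c (hullW J w) Lc + naiSLJ c (hullW J w) Ln ≤ Gs)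

/-- The computed second-order affine LJ slope bound. -/
def slopeGsLJA2 (c w : (Fin 3 × Fin 3) ⊕ Fin 3 → ℤ) (J : Fin 3 → Fin 3 × Fin 3 → ℤ) (Lc Ln : List (Fin 3 → ℤ)) : ℤ :=
  g0LJ c Lc + linLJA c w J Lc + quadL2 c w J Lc + rem3LJ c (hullW J w) Lc + naiSLJ c (hullW J w) Ln

/-- `slopeCheckLJA2` passes at the computed bound, given the guards. [formal bookkeeping] -/
theorem slopeCheckLJA2_slopeGsLJA2 {c w : (Fin 3 × Fin 3) ⊕ Fin 3 → ℤ} {J : Fin 3 → Fin 3 × Fin 3 → ℤ} {Lc Ln : List (Fin 3 → ℤ)}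
    (hc : (Lc.all fun b => ljLabelOK c (hullW J w) b) = true) (hn : (Ln.all fun b => (naiveLJ c (hullW J w) b).isSome) = true) :
    slopeCheckLJA2 c w J Lc Ln (slopeGsLJA2 c w J Lc Ln) = true := by
  unfold slopeCheckLJA2 slopeGsLJA2
  simp only [Bool.and_eq_true, decide_eq_true_eq]
  exact ⟨⟨hc, hn⟩, le_rfl⟩

/-! ## §2. Per-label extraction and algebra -/

/-- The per-label third-order estimate from `ljLabelOK`. [folklore chaining: `label_slope3_LJ`] -/
theorem label_slope3_LJ_of_ok {c w : (Fin 3 × Fin 3) ⊕ Fin 3 → ℤ} {b : Fin 3 → ℤ} (h : ljLabelOK c w b = true) (U : E3 →L[ℝ] E3)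
    (hbox : ∀ ab : Fin 3 × Fin 3, |(U (EuclideanSpace.single ab.2 (1 : ℝ))) ab.1 - (c (Sum.inl ab) : ℝ) / SC| ≤ (w (Sum.inl ab) : ℝ) / SC)
    (η : E3) (hη : ∀ i : Fin 3, |η i - (c (Sum.inr i) : ℝ) / SC| ≤ (w (Sum.inr i) : ℝ) / SC) (Δ : E3) :
    FI.mem (alphaLJ ‖cenPt c b‖) (A0lj c b) ∧ FI.mem (betaLJ ‖cenPt c b‖) (B0lj c b) ∧ FI.mem (alpha1LJ ‖cenPt c b‖ / ‖cenPt c b‖) (A1qlj c b) ∧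
      |betaLJ ‖latPt U hexFrame b + U (hcpShift + η)‖ * ⟪latPt U hexFrame b + U (hcpShift + η), Δ⟫ - betaLJ ‖cenPt c b‖ * ⟪cenPt c b, Δ⟫ -
          (alphaLJ ‖cenPt c b‖ * ⟪cenPt c b, latPt U hexFrame b + U (hcpShift + η) - cenPt c b⟫ * ⟪cenPt c b, Δ⟫ +
            betaLJ ‖cenPt c b‖ * ⟪latPt U hexFrame b + U (hcpShift + η) - cenPt c b, Δ⟫) -
          ((alpha1LJ ‖cenPt c b‖ / ‖cenPt c b‖ * ⟪cenPt c b, latPt U hexFrame b + U (hcpShift + η) - cenPt c b⟫ ^ 2 +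
              alphaLJ ‖cenPt c b‖ * ‖latPt U hexFrame b + U (hcpShift + η) - cenPt c b‖ ^ 2) * ⟪cenPt c b, Δ⟫ +
            2 * alphaLJ ‖cenPt c b‖ * ⟪cenPt c b, latPt U hexFrame b + U (hcpShift + η) - cenPt c b⟫ *
              ⟪latPt U hexFrame b + U (hcpShift + η) - cenPt c b, Δ⟫) / 2| ≤
        ((KSl3 c w b : ℤ) : ℝ) / SC / 6 * ((nd3S c w b : ℝ) / SC) * ‖Δ‖ := by
  simp only [ljLabelOK, Bool.and_eq_true, decide_eq_true_eq] at h
  obtain ⟨⟨⟨⟨hlo, htt⟩, ht0⟩, hb0⟩, hq⟩ := h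
  obtain ⟨tt, htt⟩ := Option.isSome_iff_exists.1 htt
  obtain ⟨t0, ht0⟩ := Option.isSome_iff_exists.1 ht0
  obtain ⟨B0, hb0⟩ := Option.isSome_iff_exists.1 hb0
  obtain ⟨a1q, hq⟩ := Option.isSome_iff_exists.1 hq
  have hq' : FI.divPos t0.2.1 (dot3 (cenVec c b) (cenVec c b)) = some a1q := by
    rw [a1qLJ, ht0] at hq; simpa [Q0] using hq
  have eA : A0lj c b = t0.1 := by simp [A0lj, ht0]
  have eB : B0lj c b = B0 := by simp [B0lj, hb0]
  have e1 : A1qlj c b = a1q := by simp [A1qlj, hq]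
  have eK : KSl3 c w b = kSlope3S tt := by simp [KSl3, htt]
  rw [eA, eB, e1, eK]
  exact label_slope3_LJ hlo htt ht0 hb0 hq' U hbox η hη Δ

/-- The third-order remainder sum is below `rem3LJ/SC`. [arithmetic] -/
theorem rem3LJ_sum_le (c w : (Fin 3 × Fin 3) ⊕ Fin 3 → ℤ) {Lc : List (Fin 3 → ℤ)} (hLc : Lc.Nodup) :
    ∑ b ∈ Lc.toFinset, ((KSl3 c w b : ℤ) : ℝ) / SC / 6 * ((nd3S c w b : ℝ) / SC) ≤ (rem3LJ c w Lc : ℝ) / SC := by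
  classical
  have hS : (0 : ℝ) < SC := by norm_num [SC]
  have hterm : ∀ bb : Fin 3 → ℤ, ((KSl3 c w bb : ℤ) : ℝ) / SC / 6 * ((nd3S c w bb : ℝ) / SC) ≤ ((cdiv (KSl3 c w bb * nd3S c w bb) (6 * SC) : ℤ) : ℝ) / SC := by
    intro bb
    have h := div_le_cdiv (a := KSl3 c w bb * nd3S c w bb) (b := 6 * (SC : ℤ)) (by norm_num [SC])
    push_cast at h
    rw [le_div_iff₀ hS]
    have e : ((KSl3 c w bb : ℤ) : ℝ) / SC / 6 * ((nd3S c w bb : ℝ) / SC) * SC = (KSl3 c w bb : ℝ) * (nd3S c w bb) / (6 * SC) := by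
      field_simp
    rw [e]; exact h
  have h1 : ∑ b ∈ Lc.toFinset, ((KSl3 c w b : ℤ) : ℝ) / SC / 6 * ((nd3S c w b : ℝ) / SC) ≤
      ∑ b ∈ Lc.toFinset, ((cdiv (KSl3 c w b * nd3S c w b) (6 * SC) : ℤ) : ℝ) / SC := Finset.sum_le_sum fun b _ => hterm b
  refine h1.trans (le_of_eq ?_)
  rw [← Finset.sum_div]
  congr 1
  rw [List.sum_toFinset _ hLc, rem3LJ, Int.cast_list_sum, List.map_map]
  rfl

/-- Four-fold sum commutation. [arithmetic] -/
theorem sum4_comm {α β : Type*} [Fintype α] [Fintype β] (g : α → α → β → β → ℝ) :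
    ∑ k, ∑ k', ∑ a, ∑ a', g k k' a a' = ∑ a, ∑ a', ∑ k, ∑ k', g k k' a a' := by
  calc ∑ k, ∑ k', ∑ a, ∑ a', g k k' a a' = ∑ k, ∑ a, ∑ k', ∑ a', g k k' a a' := Finset.sum_congr rfl fun k _ => Finset.sum_comm
    _ = ∑ a, ∑ k, ∑ k', ∑ a', g k k' a a' := Finset.sum_comm
    _ = ∑ a, ∑ k, ∑ a', ∑ k', g k k' a a' := Finset.sum_congr rfl fun a _ => Finset.sum_congr rfl fun k _ => Finset.sum_comm
    _ = ∑ a, ∑ a', ∑ k, ∑ k', g k k' a a' := Finset.sum_congr rfl fun a _ => Finset.sum_comm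

/-- Per-label expansion of the quadratic form through the entry deviations: `Σ_kk' T_kk' m_k m_k' = Σ_a Σ_a' D_a D_a' (Σ_kk' M_k,a M_k',a' T_kk')`
for `m_k = Σ_a M_k,a D_a`. [arithmetic] -/
theorem quad_expand (T : Fin 3 → Fin 3 → ℝ) (M : Fin 3 → Fin 3 × Fin 3 → ℝ) (D : Fin 3 × Fin 3 → ℝ) :
    ∑ k : Fin 3, ∑ k' : Fin 3, T k k' * ((∑ a : Fin 3 × Fin 3, M k a * D a) * (∑ a' : Fin 3 × Fin 3, M k' a' * D a')) =
      ∑ a : Fin 3 × Fin 3, ∑ a' : Fin 3 × Fin 3, D a * D a' * (∑ k : Fin 3, ∑ k' : Fin 3, M k a * M k' a' * T k k') := by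
  have h1 : ∀ k k', T k k' * ((∑ a : Fin 3 × Fin 3, M k a * D a) * (∑ a' : Fin 3 × Fin 3, M k' a' * D a')) =
      ∑ a : Fin 3 × Fin 3, ∑ a' : Fin 3 × Fin 3, D a * D a' * (M k a * M k' a' * T k k') := by
    intro k k'
    rw [Finset.sum_mul_sum, Finset.mul_sum]
    refine Finset.sum_congr rfl fun a _ => ?_
    rw [Finset.mul_sum]
    exact Finset.sum_congr rfl fun a' _ => by ring
  simp_rw [h1]
  rw [sum4_comm]
  refine Finset.sum_congr rfl fun a _ => Finset.sum_congr rfl fun a' _ => ?_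
  rw [Finset.mul_sum]
  refine Finset.sum_congr rfl fun k _ => ?_
  rw [Finset.mul_sum]

/-- The `M`-coefficients reproduce the displacement: `Σ_a M_b,k,a D_a = Σ_l D_kl (w_b)_l + Σ_k'l D_k'l cJr_k,(k',l)`. [arithmetic] -/
theorem sum_Mre_eq (c : (Fin 3 × Fin 3) ⊕ Fin 3 → ℤ) (J : Fin 3 → Fin 3 × Fin 3 → ℤ) (b : Fin 3 → ℤ) (D : Fin 3 × Fin 3 → ℝ) (k : Fin 3) :
    ∑ a : Fin 3 × Fin 3, Mre c J b k a * D a =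
      ∑ l : Fin 3, D (k, l) * wPt c b l + ∑ k' : Fin 3, ∑ l : Fin 3, D (k', l) * cJr c J k (k', l) := by
  rw [Fintype.sum_prod_type]
  simp only [Mre, add_mul, Finset.sum_add_distrib, ite_mul, zero_mul]
  congr 1
  · rw [Finset.sum_comm]
    refine Finset.sum_congr rfl fun l _ => ?_
    rw [Finset.sum_ite_eq Finset.univ k (fun x => wPt c b l * D (x, l))]
    simp [mul_comm]
  · exact Finset.sum_congr rfl fun k' _ => Finset.sum_congr rfl fun l _ => by ring

end Summit.AtomisticToContinuum.Crystallization.Theorems.FrustratedLawDichotomyStrainedPatchHomSlopeLJAffine2Kit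

end
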